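/-
Copyright: rh-split cell (screw, bridge) gen 16, 2026-08-27.  Splitting search over kernel-typed
RH-equivalences; a splitting `A ∧ B ⟹ RH` is conditional bookkeeping unless `A` and `B` are both proved.
Nothing here bears on the truth of RH.
-/
import Summits.RiemannHypothesis.RiemannHypothesis.Theorems.Splittings.ScrewBorelGaussB
import Summits.RiemannHypothesis.RiemannHypothesis.Theorems.Splittings.ScrewLatticeThinWall
import HarnessLib

/-!
# Gauss's law for the aliased far zeros of ζ: rows X-14 (`ENC`) and X-13′ (`LASSO` at one step)

Data (Suzuki 2023, typed in `ScrewLatticeContinuation`): for a step `h > 0` the generating function of the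
lattice samples of Suzuki's screw function continues, under the sub-exponential ceiling `CEIL(h) =
LatticeCeiling h`, to a holomorphic function on the unit disc which equals near `0` the Borel series with
charges `c_ρ = coeff ρ` (`Re c_ρ < 0`, `∑ ‖c_ρ‖ < ∞`) and poles at the ALIASED ZEROS `u_ρ^{±1}`,
`u_ρ = mult h ρ = e^{-(ρ-1/2)h}`; the INSIDE pole set `aliasedPoleSet h ⊆ 𝔻` (nonempty iff `¬RH`,
`aliasedPoleSet_nonempty_of_not_rh`) and its closure, the WALL `T_h`.

**Gauss's law** (`aliasedPoleSet_inter_ball_eq_empty_of_latticeCeiling`, from the ζ-free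
`ScrewBorelGauss.poleSet_inter_ball_eq_empty`): under `CEIL(h)`, every circle `sphere a R` with
`closedBall a R ⊆ 𝔻` lying in the origin's component `Ω₀(h)` of `𝔻 ∖ T_h` bounds an open disc containing NO
aliased far zero — one circle, any centre, any radius (it subsumes the small-circles theorem
`ScrewLatticeThinWall.not_small_circles_of_latticeCeiling` and the flux quantisation there).

**Row X-14** (`latticeCeiling_and_encirclable_iff_rh`): `CEIL(h) ∧ ENC(h) ↔ RH` for every `h > 0`, where
`ENC(h)` = «if there are aliased far zeros in `𝔻`, some circle of `Ω₀(h)` with closed disc in `𝔻` encloses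
one».  **Row X-13′** (`latticeCeiling_and_lasso_iff_rh`): `CEIL(h) ∧ LASSO(h) ↔ RH`, `LASSO(h)` = «circles
`‖z‖ = r` of `Ω₀(h)` with `r → 1⁻`» — the per-step collapse of route `Theses.ScrewLasso` (no `h → 0⁺`, no
charge-continuity limit); its crux `LassoFlux` holds outright (`lassoFlux`).  Containments (RH-free):
`TW(h) ⟹ LASSO(h) ⟹ ENC(h)` (`lasso_of_thinWall`, `encirclable_of_lasso`), so X-14 ⊇ X-13′ ⊇ X-10 ⊇ X-9.
**Dichotomy** (`latticeCeiling_dichotomy_circles`): `CEIL(h) ⟹ RH ∨` [aliased far zeros exist and every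
circle of `Ω₀(h)` with closed disc in `𝔻` bounds a disc free of them].

No `sorry`, no new axioms, no instances, no notation.
-/

set_option linter.dupNamespace false

namespace Summit.RiemannHypothesis.RiemannHypothesis.Theorems.Splittings.ScrewLatticeGauss

open Complex Filter Topology Set Metric MeasureTheory
open scoped ENNReal
open Literature.NumberTheory.LFunctions
open Summit.RiemannHypothesis.RiemannHypothesis.Theorems.Splittings
open Summit.RiemannHypothesis.RiemannHypothesis.Theorems.Splittings.ScrewBorel
open Summit.RiemannHypothesis.RiemannHypothesis.Theorems.Splittings.ScrewBorelFlux
open Summit.RiemannHypothesis.RiemannHypothesis.Theorems.Splittings.ScrewBorelGauss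
open Summit.RiemannHypothesis.RiemannHypothesis.Theorems.Splittings.ScrewLatticeContinuation
open Summit.RiemannHypothesis.RiemannHypothesis.Theorems.Splittings.ScrewLatticeThinWall

/-! ## 1. The origin's component `Ω₀(h)` and Gauss's law under `CEIL(h)` -/

/-- `Ω₀(h)`: the connected component of the origin in `𝔻 ∖ T_h`, `T_h = closure (aliasedPoleSet h)`. -/
def originComponent (h : ℝ) : Set ℂ :=
  connectedComponentIn (ball (0 : ℂ) 1 \ closure (aliasedPoleSet h)) 0

/-- `Ω₀(h) ⊆ 𝔻 ∖ T_h`. -/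
theorem originComponent_subset (h : ℝ) :
    originComponent h ⊆ ball 0 1 \ closure (aliasedPoleSet h) :=
  connectedComponentIn_subset _ _

/-- `Ω₀(h)` is preconnected. -/
theorem isPreconnected_originComponent (h : ℝ) : IsPreconnected (originComponent h) :=
  isPreconnected_connectedComponentIn

/-- `0 ∈ Ω₀(h)` for `h ≥ 0` (the disc `‖z‖ < e^{-h/2}` carries no aliased zero). -/
theorem zero_mem_originComponent {h : ℝ} (hh : 0 ≤ h) : (0 : ℂ) ∈ originComponent h :=
  zero_mem_component (u := mult h) (Real.exp_pos (-(h / 2)))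
    (fun _ hp ↦ exp_neg_half_le_norm_of_mem hh hp)

/-- Any preconnected `V ∋ 0` inside `𝔻 ∖ T_h` lies in `Ω₀(h)`. -/
theorem subset_originComponent {h : ℝ} {V : Set ℂ} (hV : IsPreconnected V) (hV0 : (0 : ℂ) ∈ V)
    (hVsub : V ⊆ ball 0 1 \ closure (aliasedPoleSet h)) : V ⊆ originComponent h :=
  hV.subset_connectedComponentIn hV0 hVsub

/-- **GAUSS'S LAW for the aliased far zeros** (`h > 0`, RH-free).  Under `CEIL(h)`, a circle `sphere a R`
(`R > 0`, `closedBall a R ⊆ 𝔻`) contained in a preconnected `V ∋ 0` inside `𝔻 ∖ T_h` bounds an open disc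
free of aliased far zeros: `aliasedPoleSet h ∩ ball a R = ∅`. -/
theorem aliasedPoleSet_inter_ball_eq_empty_of_latticeCeiling {h : ℝ} (hh : 0 < h)
    (hceil : LatticeCeiling h) {V : Set ℂ} (hV : IsPreconnected V) (hV0 : (0 : ℂ) ∈ V)
    (hVsub : V ⊆ ball 0 1 \ closure (aliasedPoleSet h))
    {a : ℂ} {R : ℝ} (hR : 0 < R) (haR : closedBall a R ⊆ ball (0 : ℂ) 1) (hSV : sphere a R ⊆ V) :
    aliasedPoleSet h ∩ ball a R = ∅ :=
  poleSet_inter_ball_eq_empty (c := coeff) (u := mult h) summable_norm_coeff re_coeff_neg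
    (mult_ne_zero h) (differentiableOn_latticeGF hceil) (Real.exp_pos (-(h / 2)))
    (fun _ hp ↦ exp_neg_half_le_norm_of_mem hh.le hp)
    (fun _ hz ↦ latticeGF_eq_borel hh (mem_ball_zero_iff.1 hz)) hV hV0 hVsub hR haR hSV

/-- Component form of Gauss's law: a circle of `Ω₀(h)` with closed disc in `𝔻` bounds a disc free of
aliased far zeros. -/
theorem aliasedPoleSet_inter_ball_eq_empty_of_originComponent {h : ℝ} (hh : 0 < h)
    (hceil : LatticeCeiling h) {a : ℂ} {R : ℝ} (hR : 0 < R) (haR : closedBall a R ⊆ ball (0 : ℂ) 1)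
    (hS : sphere a R ⊆ originComponent h) : aliasedPoleSet h ∩ ball a R = ∅ :=
  aliasedPoleSet_inter_ball_eq_empty_of_latticeCeiling hh hceil (isPreconnected_originComponent h)
    (zero_mem_originComponent hh.le) (originComponent_subset h) hR haR hS

/-! ## 2. Row X-14: `CEIL(h) ∧ ENC(h) ⟺ RH` -/

/-- `ENC(h)` («encirclable»): if there are aliased far zeros in `𝔻` at all, then SOME circle `sphere a R`
of the origin's component `Ω₀(h)` of `𝔻 ∖ T_h`, with `closedBall a R ⊆ 𝔻`, encloses one of them.  Open;
RH-implied (vacuously, `encirclable_of_rh`); implied by `LASSO(h)` and by `TW(h)`. -/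
@[conjecture] def Encirclable (h : ℝ) : Prop :=
  (aliasedPoleSet h).Nonempty → ∃ a : ℂ, ∃ R : ℝ, 0 < R ∧ closedBall a R ⊆ ball (0 : ℂ) 1 ∧
    sphere a R ⊆ originComponent h ∧ (aliasedPoleSet h ∩ ball a R).Nonempty

/-- **RH ⟹ ENC(h)** (vacuously: no aliased far zeros). -/
theorem encirclable_of_rh (hRH : RiemannHypothesis) (h : ℝ) : Encirclable h := by
  intro hne
  rw [aliasedPoleSet_eq_empty_of_rh hRH] at hne
  exact absurd hne Set.not_nonempty_empty

/-- **`CEIL(h) ∧ ENC(h) ⟹` no aliased far zeros** (`h > 0`). -/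
theorem aliasedPoleSet_eq_empty_of_latticeCeiling_of_encirclable {h : ℝ} (hh : 0 < h)
    (hceil : LatticeCeiling h) (henc : Encirclable h) : aliasedPoleSet h = ∅ := by
  rcases Set.eq_empty_or_nonempty (aliasedPoleSet h) with h0 | hne
  · exact h0
  obtain ⟨a, R, hR, haR, hS, hin⟩ := henc hne
  rw [aliasedPoleSet_inter_ball_eq_empty_of_originComponent hh hceil hR haR hS] at hin
  exact absurd hin Set.not_nonempty_empty

/-- **`CEIL(h) ∧ ENC(h) ⟹ RH`** (`h > 0`). -/
theorem rh_of_latticeCeiling_of_encirclable {h : ℝ} (hh : 0 < h) (hceil : LatticeCeiling h)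
    (henc : Encirclable h) : RiemannHypothesis := by
  by_contra hnot
  have hne := aliasedPoleSet_nonempty_of_not_rh hh hnot
  rw [aliasedPoleSet_eq_empty_of_latticeCeiling_of_encirclable hh hceil henc] at hne
  exact Set.not_nonempty_empty hne

/-- **ROW X-14 (the splitting)**, `h > 0` arbitrary: `CEIL(h) ∧ ENC(h) ↔ RiemannHypothesis`. -/
theorem latticeCeiling_and_encirclable_iff_rh {h : ℝ} (hh : 0 < h) :
    (LatticeCeiling h ∧ Encirclable h) ↔ RiemannHypothesis :=
  ⟨fun hab ↦ rh_of_latticeCeiling_of_encirclable hh hab.1 hab.2,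
    fun hRH ↦ ⟨latticeCeiling_of_rh hRH h, encirclable_of_rh hRH h⟩⟩

/-- **THE DICHOTOMY (RH-free content)**, `h > 0`: under `CEIL(h)`, EITHER the Riemann hypothesis holds OR
there are aliased far zeros in `𝔻` and every circle of `Ω₀(h)` with closed disc in `𝔻` bounds a disc free
of them (the wall `T_h` cuts every far zero off from every circle linked to the origin). -/
theorem latticeCeiling_dichotomy_circles {h : ℝ} (hh : 0 < h) (hceil : LatticeCeiling h) :
    RiemannHypothesis ∨ ((aliasedPoleSet h).Nonempty ∧ ∀ (a : ℂ) (R : ℝ), 0 < R →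
      closedBall a R ⊆ ball (0 : ℂ) 1 → sphere a R ⊆ originComponent h →
        aliasedPoleSet h ∩ ball a R = ∅) := by
  by_cases hRH : RiemannHypothesis
  · exact Or.inl hRH
  · exact Or.inr ⟨aliasedPoleSet_nonempty_of_not_rh hh hRH,
      fun a R hR haR hS ↦ aliasedPoleSet_inter_ball_eq_empty_of_originComponent hh hceil hR haR hS⟩

/-! ## 3. Lassos: the `ScrewLasso` line at ONE step (row X-13′) -/

/-- `LASSO(h)`: origin-centred circles `‖z‖ = r` with `r` arbitrarily close to `1` lie in the origin's
component of `𝔻 ∖ T_h` (the per-step form of `Theses.ScrewLasso.LassoFine`).  Open; RH-implied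
(`lasso_of_rh`); implied by `TW(h)` (`lasso_of_thinWall`). -/
@[conjecture] def Lasso (h : ℝ) : Prop :=
  ∀ η : ℝ, 0 < η → ∃ r ∈ Ioo (1 - η) 1, sphere (0 : ℂ) r ⊆ originComponent h

/-- **RH ⟹ LASSO(h)** (no wall: `Ω₀(h) = 𝔻`). -/
theorem lasso_of_rh (hRH : RiemannHypothesis) (h : ℝ) : Lasso h := by
  intro η hη
  refine ⟨1 - min η 1 / 2, ⟨by
    have := min_le_left η 1; linarith, by
    have := lt_min hη one_pos; linarith⟩, ?_⟩
  have hr1 : 1 - min η 1 / 2 < 1 := by have := lt_min hη one_pos; linarith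
  have hsub : ball (0 : ℂ) 1 ⊆ ball 0 1 \ closure (aliasedPoleSet h) := by
    rw [aliasedPoleSet_eq_empty_of_rh hRH, closure_empty]
    exact fun z hz ↦ ⟨hz, Set.notMem_empty z⟩
  exact (sphere_subset_closedBall.trans (closedBall_subset_ball hr1)).trans
    ((convex_ball (0 : ℂ) 1).isPreconnected.subset_connectedComponentIn (mem_ball_self one_pos) hsub)

/-- **LASSO(h) ⟹ ENC(h)**: a lasso of radius `r > ‖p‖` encircles the aliased zero `p`. -/
theorem encirclable_of_lasso {h : ℝ} (hl : Lasso h) : Encirclable h := by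
  rintro ⟨p, hp⟩
  have hp1 : ‖p‖ < 1 := hp.1
  obtain ⟨r, hr, hrs⟩ := hl (1 - ‖p‖) (by linarith)
  have hr0 : 0 < r := by linarith [hr.1, norm_nonneg p]
  exact ⟨0, r, hr0, closedBall_subset_ball hr.2, hrs,
    p, hp, mem_ball_zero_iff.2 (by linarith [hr.1])⟩

/-- **TW(h) ⟹ LASSO(h)** (`h ≥ 0`): a wall of zero length admits lassos (good radii). -/
theorem lasso_of_thinWall {h : ℝ} (hh : 0 ≤ h) (htw : ThinWall h) : Lasso h :=
  fun _ hη ↦ lassos_of_hausdorffMeasure_zero (u := mult h) (Real.exp_pos (-(h / 2)))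
    (fun _ hp ↦ exp_neg_half_le_norm_of_mem hh hp) htw hη

/-- **TW(h) ⟹ ENC(h)** (`h ≥ 0`): row X-14 contains row X-10. -/
theorem encirclable_of_thinWall {h : ℝ} (hh : 0 ≤ h) (htw : ThinWall h) : Encirclable h :=
  encirclable_of_lasso (lasso_of_thinWall hh htw)

/-- **One lasso pushes the far zeros out.**  Under `CEIL(h)` (`h > 0`), a circle `‖z‖ = r` of `Ω₀(h)`
(`0 < r < 1`) forces every aliased far zero OUTSIDE it: `r < ‖p‖`, i.e. `|Re ρ - 1/2|·h < -log r`. -/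
theorem lt_norm_of_lasso_of_latticeCeiling {h : ℝ} (hh : 0 < h) (hceil : LatticeCeiling h)
    {r : ℝ} (hr : 0 < r) (hr1 : r < 1) (hrs : sphere (0 : ℂ) r ⊆ originComponent h) :
    ∀ p ∈ aliasedPoleSet h, r < ‖p‖ :=
  lt_norm_of_sphere_zero_subset (c := coeff) (u := mult h) summable_norm_coeff re_coeff_neg
    (mult_ne_zero h) (differentiableOn_latticeGF hceil) (Real.exp_pos (-(h / 2)))
    (fun _ hp ↦ exp_neg_half_le_norm_of_mem hh.le hp)
    (fun _ hz ↦ latticeGF_eq_borel hh (mem_ball_zero_iff.1 hz)) (isPreconnected_originComponent h)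
    (zero_mem_originComponent hh.le) (originComponent_subset h) hr hr1 hrs

/-- **`CEIL(h) ∧ LASSO(h) ⟹` no aliased far zeros** (`h > 0`). -/
theorem aliasedPoleSet_eq_empty_of_latticeCeiling_of_lasso {h : ℝ} (hh : 0 < h)
    (hceil : LatticeCeiling h) (hl : Lasso h) : aliasedPoleSet h = ∅ :=
  aliasedPoleSet_eq_empty_of_latticeCeiling_of_encirclable hh hceil (encirclable_of_lasso hl)

/-- **`CEIL(h) ∧ LASSO(h) ⟹ RH`** (`h > 0`): the `ScrewLasso` line closes at ONE step. -/
theorem rh_of_latticeCeiling_of_lasso {h : ℝ} (hh : 0 < h) (hceil : LatticeCeiling h)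
    (hl : Lasso h) : RiemannHypothesis :=
  rh_of_latticeCeiling_of_encirclable hh hceil (encirclable_of_lasso hl)

/-- **ROW X-13′**, `h > 0` arbitrary: `CEIL(h) ∧ LASSO(h) ↔ RiemannHypothesis`. -/
theorem latticeCeiling_and_lasso_iff_rh {h : ℝ} (hh : 0 < h) :
    (LatticeCeiling h ∧ Lasso h) ↔ RiemannHypothesis :=
  ⟨fun hab ↦ rh_of_latticeCeiling_of_lasso hh hab.1 hab.2,
    fun hRH ↦ ⟨latticeCeiling_of_rh hRH h, lasso_of_rh hRH h⟩⟩

/-- With no aliased far zeros every disc weight at `(0, 1)` vanishes. -/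
theorem discWeight_zero_one_eq_zero_of_empty {h : ℝ} (hem : aliasedPoleSet h = ∅)
    (ρ : ZetaZeros.riemannZetaNontrivialZeros) : discWeight (coeff ρ) (mult h ρ) 0 1 = 0 := by
  have hno : ∀ q : ℂ, (q = mult h ρ ∨ q = (mult h ρ)⁻¹) → ¬ ‖q - 0‖ < 1 := by
    intro q hq hlt
    rw [sub_zero] at hlt
    have hmem : q ∈ aliasedPoleSet h := ⟨hlt, ρ, hq⟩
    rw [hem] at hmem
    exact hmem
  unfold discWeight
  rw [if_neg (hno _ (Or.inr rfl)), if_neg (hno _ (Or.inl rfl)), add_zero]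

/-- **The crux `Theses.ScrewLasso.LassoFlux` holds outright** (stated literally): under `CEIL(h)` and
lassos at step `h > 0` there are no aliased far zeros (`aliasedPoleSet_eq_empty_of_latticeCeiling_of_lasso`),
so the total charge of the unit disc `∑_ρ discWeight c_ρ u_ρ 0 1` is an empty sum. -/
theorem lassoFlux : ∀ h : ℝ, 0 < h → LatticeCeiling h →
    (∀ δ : ℝ, 0 < δ → ∃ r ∈ Set.Ioo (1 - δ) 1, Metric.sphere (0 : ℂ) r ⊆
      connectedComponentIn (Metric.ball (0 : ℂ) 1 \ closure (aliasedPoleSet h)) 0) →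
    ∑' ρ : ZetaZeros.riemannZetaNontrivialZeros, discWeight (coeff ρ) (mult h ρ) 0 1 = 0 := by
  intro h hh hceil hl
  have hem := aliasedPoleSet_eq_empty_of_latticeCeiling_of_lasso hh hceil hl
  simp [discWeight_zero_one_eq_zero_of_empty hem]

/-- `LassoFine`, the zero-side crux of `Theses.ScrewLasso` (lassos at arbitrarily fine steps), stated
literally, implies RH together with the ceiling AT THE SAME STEPS — no charge-continuity limit `h → 0⁺`
is needed (compare `Theses.ScrewLasso.ChargeContinuity`). -/
theorem rh_of_lassoFine_of_ceilAll
    (hfine : ∀ δ : ℝ, 0 < δ → ∃ h ∈ Set.Ioo 0 δ, ∀ η : ℝ, 0 < η → ∃ r ∈ Set.Ioo (1 - η) 1,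
      Metric.sphere (0 : ℂ) r ⊆
        connectedComponentIn (Metric.ball (0 : ℂ) 1 \ closure (aliasedPoleSet h)) 0)
    (hceil : ∀ h : ℝ, 0 < h → LatticeCeiling h) : RiemannHypothesis := by
  obtain ⟨h, hh, hl⟩ := hfine 1 one_pos
  exact rh_of_latticeCeiling_of_lasso hh.1 (hceil h hh.1) hl

end Summit.RiemannHypothesis.RiemannHypothesis.Theorems.Splittings.ScrewLatticeGauss
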